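import Mathlib
import HarnessLib
import Summits.ValiantsHypothesis.ValiantsHypothesis.Theorems.LacunarySymmetroidMatrixDescartesProductPlusOneRowTowerKCloudTransferTopCert
import Summits.ValiantsHypothesis.ValiantsHypothesis.Theorems.LacunarySymmetroidMatrixDescartesProductPlusOneRowTowerKCloudTransfer

/-!
# LINE (A) `product_plus_one` (crux `MatrixDescartes`, stmt-ValiantsHypothesis-18050, V1) — W-CB §30.5 C5, THE CLOUD TRANSFER LAW, TOP SIDE:
# ★★ on the side where `f` has the sign of its isolated TOP coefficient, the order-8 image of a trinomial cloud `(+,+,−)`/`(−,−,+)` is POSITIVE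
# whenever the outer gap is at least the inner one (`λ₁ ≥ 2λ₀`) — such a cloud is a FREE row of the zone count on its pole side

Currency as ✓⧗ `…RowTowerKCloudTransfer` (every-K tower, `n = 2`, rates `a = λ₀ < c = λ₁`, `g = c − a`; image `ψ₇ − e₁ψ₅ + e₂ψ₃ − e₃ψ₁`).
* ★★ `rowPsiK_image8_pos_of_cloud_top` — `0 < λ₀`, `2λ₀ ≤ λ₁`, `0 < x`, `0 < A`, `B₀ < 0`, `0 < B₁`, `A − B₀x^{λ₀} − B₁x^{λ₁} < 0` (a `(+,+,−)` cloud on its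
  pole side) ⇒ image `> 0`: by ★ `rowPsiK_image8_two_transfer_top` the image times `(Q−A−p)⁸(Q−p)⁸ > 0` (`p = −B₀x^{λ₀}`, `Q = B₁x^{λ₁}`, `Q > A + p`) is
  `Q²p²·W·(Q−A−p)⁸ + Σ E_{mk}(g,a)·p^m A^{k+1}(Q−p)^{8−m}(Q−A−p)^{7−k}`, every factor nonnegative (`W`'s brackets `c−2a ≥ 0`, `2c−3a`, `2c−a`, `3c−2a`, `c−a > 0`).
* ★★ `rowPsiK_image8_pos_of_cloud_top'` — sign-symmetric hypotheses `A·B₀ < 0`, `0 < A·B₁`, `A·f(x) < 0` (both orientations, via ✓⧗ `rowPsiK7_neg` &c.).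
Together with the bottom-side law: under E3b's ratio hypothesis `g ≥ 2a` BOTH one-change cloud types of the floor's class have a free side — `(+,−,−)` where
`f` has its bottom sign, `(+,+,−)` where `f` has its top sign; the other sides (switched T5 / flat T4) carry the located charges of memo §30.2 and are NOT
claimed.  HONEST FRAMING: per-row sign law (helper); no stub closes; `WronskianBudgetK3` / `OneChangeFloorK3` / 18050 / `MatrixDescartes` OPEN;
`VP ≠ VNP` is NOT proved.  No definitions, no named facts, no sorry.
-/

set_option linter.dupNamespace false

namespace Summit.ValiantsHypothesis.ValiantsHypothesis.Theorems.LacunarySymmetroidMatrixDescartes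

namespace ProductPlusOne

open Finset
open scoped BigOperators

/-- ★★ **CLOUD TRANSFER LAW, top-isolated side (`A > 0` orientation).**  Tail `n = 2`, `0 < λ₀`, `2λ₀ ≤ λ₁`; `0 < x`; `0 < A`, `B₀ < 0`, `0 < B₁`
(a `(+,+,−)` cloud in stripped form `A − B₀x^{λ₀} − B₁x^{λ₁}`) at a point of its POLE side `A − B₀x^{λ₀} − B₁x^{λ₁} < 0`.  Then the order-8 image
`ψ₇ − e₁ψ₅ + e₂ψ₃ − e₃ψ₁` is POSITIVE. [this file's theorem] -/
theorem rowPsiK_image8_pos_of_cloud_top (lam : Fin 2 → ℕ) (h0 : 0 < lam 0) (h2 : 2 * lam 0 ≤ lam 1)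
    (A : ℝ) (B : Fin 2 → ℝ) {x : ℝ} (hx : 0 < x) (hA : 0 < A) (hB0 : B 0 < 0) (hB1 : 0 < B 1)
    (hF : A - B 0 * x ^ lam 0 - B 1 * x ^ lam 1 < 0) :
    0 < rowPsiK7 lam A B x - ((lam 0 : ℝ) ^ 2 + ((lam 1 : ℝ) - lam 0) ^ 2 + (lam 1 : ℝ) ^ 2) * rowPsiK5 lam A B x
          + ((lam 0 : ℝ) ^ 2 * ((lam 1 : ℝ) - lam 0) ^ 2 + (lam 0 : ℝ) ^ 2 * (lam 1 : ℝ) ^ 2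
              + ((lam 1 : ℝ) - lam 0) ^ 2 * (lam 1 : ℝ) ^ 2) * rowPsiK3 lam A B x
          - ((lam 0 : ℝ) ^ 2 * ((lam 1 : ℝ) - lam 0) ^ 2 * (lam 1 : ℝ) ^ 2) * rowPsiK1 lam A B x := by
  obtain ⟨a, ha⟩ : ∃ a : ℝ, (lam 0 : ℝ) = a := ⟨_, rfl⟩
  obtain ⟨c, hc⟩ : ∃ c : ℝ, (lam 1 : ℝ) = c := ⟨_, rfl⟩
  obtain ⟨p, hp⟩ : ∃ p : ℝ, B 0 * x ^ lam 0 = -p := ⟨-(B 0 * x ^ lam 0), by ring⟩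
  obtain ⟨Q, hQ⟩ : ∃ Q : ℝ, B 1 * x ^ lam 1 = Q := ⟨_, rfl⟩
  have hapos : 0 < a := by rw [← ha]; exact_mod_cast h0
  have hca : 2 * a ≤ c := by rw [← ha, ← hc]; exact_mod_cast h2
  have hg : 0 < c - a := by linarith
  have h1 : 0 ≤ c - 2 * a := by linarith
  have h2' : 0 < 2 * c - 3 * a := by linarith
  have h3' : 0 < 2 * c - a := by linarith
  have h4' : 0 < 3 * c - 2 * a := by linarith
  have hppos : 0 < p := by
    have : B 0 * x ^ lam 0 < 0 := mul_neg_of_neg_of_pos hB0 (by positivity)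
    linarith
  have hQpos : 0 < Q := by rw [← hQ]; positivity
  rw [hp, hQ] at hF
  have hFs : 0 < Q - A - p := by linarith
  have hd : 0 < Q - p := by linarith
  obtain ⟨W, hW⟩ : ∃ W : ℝ, W = (Q - p) ^ 4 * (6 * (c - a) ^ 4 * (c - 2 * a) * (2 * c - 3 * a) * (2 * c - a) * (3 * c - 2 * a))
      + Q * p * (Q - p) ^ 2 * (240 * (c - a) ^ 6 * (2 * c - 3 * a) * (3 * c - 2 * a)) + Q ^ 2 * p ^ 2 * (5040 * (c - a) ^ 8) := ⟨_, rfl⟩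
  have hWpos : 0 < W := by rw [hW]; positivity
  have key := rowPsiK_image8_two_transfer_top lam A B x a c p Q ha hc hp hQ hFs.ne' W hW
  have hprod : 0 < (rowPsiK7 lam A B x - (a ^ 2 + (c - a) ^ 2 + c ^ 2) * rowPsiK5 lam A B x
        + (a ^ 2 * (c - a) ^ 2 + a ^ 2 * c ^ 2 + (c - a) ^ 2 * c ^ 2) * rowPsiK3 lam A B x
        - (a ^ 2 * (c - a) ^ 2 * c ^ 2) * rowPsiK1 lam A B x) * (Q - A - p) ^ 8 * (Q - p) ^ 8 := by
    rw [key]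
    clear key hW hca h0 h2 ha hc hp hQ hB0 hB1 hx hF h1 h2' h3' h4'
    positivity
  have hden : 0 < (Q - A - p) ^ 8 * (Q - p) ^ 8 := by positivity
  rw [mul_assoc] at hprod
  have himg := (mul_pos_iff_of_pos_right hden).mp hprod
  rw [ha, hc]
  exact himg

/-- ★★ **CLOUD TRANSFER LAW, top-isolated side, sign-symmetric form.**  As ★★ `rowPsiK_image8_pos_of_cloud_top` with the hypotheses `A·B₀ < 0`,
`0 < A·B₁`, `A·(A − B₀x^{λ₀} − B₁x^{λ₁}) < 0` — a `(+,+,−)` OR `(−,−,+)` cloud at a point where `f` has the sign of its isolated TOP coefficient.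
[this file's theorem] -/
theorem rowPsiK_image8_pos_of_cloud_top' (lam : Fin 2 → ℕ) (h0 : 0 < lam 0) (h2 : 2 * lam 0 ≤ lam 1)
    (A : ℝ) (B : Fin 2 → ℝ) {x : ℝ} (hx : 0 < x) (hAB0 : A * B 0 < 0) (hAB1 : 0 < A * B 1)
    (hAF : A * (A - B 0 * x ^ lam 0 - B 1 * x ^ lam 1) < 0) :
    0 < rowPsiK7 lam A B x - ((lam 0 : ℝ) ^ 2 + ((lam 1 : ℝ) - lam 0) ^ 2 + (lam 1 : ℝ) ^ 2) * rowPsiK5 lam A B x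
          + ((lam 0 : ℝ) ^ 2 * ((lam 1 : ℝ) - lam 0) ^ 2 + (lam 0 : ℝ) ^ 2 * (lam 1 : ℝ) ^ 2
              + ((lam 1 : ℝ) - lam 0) ^ 2 * (lam 1 : ℝ) ^ 2) * rowPsiK3 lam A B x
          - ((lam 0 : ℝ) ^ 2 * ((lam 1 : ℝ) - lam 0) ^ 2 * (lam 1 : ℝ) ^ 2) * rowPsiK1 lam A B x := by
  rcases pos_and_pos_or_neg_and_neg_of_mul_pos hAB1 with ⟨hA, hB1⟩ | ⟨hA, hB1⟩
  · have hB0 : B 0 < 0 := by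
      by_contra h
      have : 0 ≤ A * B 0 := mul_nonneg hA.le (not_lt.mp h)
      linarith
    have hF : A - B 0 * x ^ lam 0 - B 1 * x ^ lam 1 < 0 := by
      by_contra h
      have : 0 ≤ A * (A - B 0 * x ^ lam 0 - B 1 * x ^ lam 1) := mul_nonneg hA.le (not_lt.mp h)
      linarith
    exact rowPsiK_image8_pos_of_cloud_top lam h0 h2 A B hx hA hB0 hB1 hF
  · have hB0 : 0 < B 0 := by
      by_contra h
      have : 0 ≤ A * B 0 := mul_nonneg_of_nonpos_of_nonpos hA.le (not_lt.mp h)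
      linarith
    have hF : 0 < A - B 0 * x ^ lam 0 - B 1 * x ^ lam 1 := by
      by_contra h
      have : 0 ≤ A * (A - B 0 * x ^ lam 0 - B 1 * x ^ lam 1) := mul_nonneg_of_nonpos_of_nonpos hA.le (not_lt.mp h)
      linarith
    have h := rowPsiK_image8_pos_of_cloud_top lam h0 h2 (-A) (fun l => -B l) hx (neg_pos.2 hA)
      (by simpa using hB0) (by simpa using neg_pos.2 hB1) (by simp only [neg_mul]; linarith)
    simpa only [rowPsiK7_neg, rowPsiK5_neg, rowPsiK3_neg, rowPsiK1_neg] using h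

end ProductPlusOne

end Summit.ValiantsHypothesis.ValiantsHypothesis.Theorems.LacunarySymmetroidMatrixDescartes
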